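import Summits.Ventures.PercRepro.SixThreeRule

/-!
# PercRepro — the `(7,3)` cell: weighted flat counts of a restriction and the coloop direct sum (p3, gen 15)

Under the `θ = 6` span rule (`SixThreeRule.lean`: `fRule`, `D`) the denominator `D(S) = Σ_{P ∈ planes M} f(P, S)` is a sum
over the rank-`3` flats of the restriction `M|S`: the traces `S ∩ P` of rank `3`, one per plane `P` (`P = cl(S ∩ P)`).
This file introduces the weighted counts `Φ_r(K) := Σ_{F rank-r flat of M|K} 6^{|F| − r}` for every rank `r`, identifies
`D K = Φ_3(K)` (`D_eq_Phi_three`), and proves the coloop step `Φ_r(insert y K) = Φ_r(K) + Φ_{r−1}(K)` for `y ∉ cl(K)`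
(`Phi_insert_of_notMem_closure`), hence the direct-sum formula `Φ_r(K ∪ Y) = Σ_j C(|Y|, j)·Φ_{r−j}(K)` when every `y ∈ Y`
lies outside `cl(K ∪ (Y ∖ y))` (`Phi_union_of_coloops`): the rank-`r` flats of `M|(K ∪ Y)` are `F ⊔ Y'` with `F` a flat of
`M|K` of rank `r − |Y'|`. This is the `(7,3)` plan of record (`P3-C025-seven-three-plan.md` §6, M1); p5's
`D_insert_le_of_notMem_closure` (`SixThreeColoop.lean`) is the `r = 3` inequality half of the coloop step.
-/

namespace PercRepro

namespace SevenThree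

open Finset ThmH SixThree

variable {α : Type*} [DecidableEq α] {M : Matroid α} [M.Finite]

open scoped Classical in
/-- The rank-`r` flats of the restriction `M|K`: the subsets `F ⊆ K` of rank `r` such that every point of `K` outside
`F` raises the rank to `r + 1`. -/
noncomputable def flatsRestr (M : Matroid α) [M.Finite] (K : Finset α) (r : ℕ) : Finset (Finset α) :=
  K.powerset.filter (fun F => M.eRk (F : Set α) = (r : ℕ∞) ∧
    ∀ e ∈ K, e ∉ F → M.eRk ((insert e F : Finset α) : Set α) = ((r + 1 : ℕ) : ℕ∞))

/-- The weighted flat count `Φ_r(K) = Σ_{F ∈ flatsRestr M K r} 6^{|F| − r}` of the `θ = 6` rule. -/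
noncomputable def Phi (M : Matroid α) [M.Finite] (r : ℕ) (K : Finset α) : ℚ :=
  ∑ F ∈ flatsRestr M K r, (6 : ℚ) ^ (F.card - r)

/-- Membership in `flatsRestr`. -/
theorem mem_flatsRestr {K F : Finset α} {r : ℕ} :
    F ∈ flatsRestr M K r ↔ F ⊆ K ∧ M.eRk (F : Set α) = (r : ℕ∞) ∧
      ∀ e ∈ K, e ∉ F → M.eRk ((insert e F : Finset α) : Set α) = ((r + 1 : ℕ) : ℕ∞) := by
  unfold flatsRestr
  simp only [Finset.mem_filter, Finset.mem_powerset]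

/-- A point of the closure of `F ⊆ E` does not raise the rank of `F`. -/
theorem eRk_insert_eq_of_mem_closure {F : Finset α} (hF : F ⊆ gr M) {e : α}
    (he : e ∈ M.closure (F : Set α)) :
    M.eRk ((insert e F : Finset α) : Set α) = M.eRk (F : Set α) := by
  have hFE : (F : Set α) ⊆ M.E := by rw [← coe_gr M]; exact_mod_cast hF
  apply le_antisymm
  · calc M.eRk ((insert e F : Finset α) : Set α) ≤ M.eRk (M.closure (F : Set α)) := by
          apply M.eRk_mono
          rw [Finset.coe_insert]
          exact Set.insert_subset he (M.subset_closure (F : Set α) hFE)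
      _ = M.eRk (F : Set α) := M.eRk_closure_eq _
  · apply M.eRk_mono
    rw [Finset.coe_insert]
    exact Set.subset_insert _ _

/-- A point of the ground set outside the closure of `F` raises the rank of `F` by one. -/
theorem eRk_insert_eq_succ_of_notMem_closure {F : Finset α} {e : α} (he : e ∈ gr M)
    (hecl : e ∉ M.closure (F : Set α)) :
    M.eRk ((insert e F : Finset α) : Set α) = M.eRk (F : Set α) + 1 := by
  have heE : e ∈ M.E := by rw [← coe_gr M]; exact_mod_cast he
  rw [Finset.coe_insert]
  exact Matroid.eRk_insert_eq_add_one ⟨heE, hecl⟩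

/-- **`D(K) = Φ_3(K)`**: the planes `P` of `M` with a rank-`3` trace on `K` correspond bijectively (`P ↦ K ∩ P`,
inverse `F ↦ cl(F)`) to the rank-`3` flats of `M|K`, with the same weight `6^{|K ∩ P| − 3}`. -/
theorem D_eq_Phi_three {K : Finset α} (hK : K ⊆ gr M) : D M K = Phi M 3 K := by
  classical
  unfold D Phi
  have hsplit : ∑ P ∈ planes M, fRule M P K =
      ∑ P ∈ (planes M).filter (fun P => M.eRk ((K ∩ P : Finset α) : Set α) = 3),
        (6 : ℚ) ^ ((K ∩ P).card - 3) := by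
    rw [Finset.sum_filter]
    apply Finset.sum_congr rfl
    intro P _
    unfold fRule
    split_ifs <;> rfl
  rw [hsplit]
  refine Finset.sum_nbij' (fun P => K ∩ P) (fun F => clF M F) ?_ ?_ ?_ ?_ ?_
  · -- the trace of a plane with rank-`3` trace is a rank-`3` flat of `M|K`
    intro P hP
    rw [Finset.mem_filter] at hP
    obtain ⟨hP, hr⟩ := hP
    rw [mem_flatsRestr]
    refine ⟨Finset.inter_subset_left, hr, ?_⟩
    intro e he heF
    have heP : e ∉ P := fun h => heF (Finset.mem_inter.2 ⟨he, h⟩)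
    rw [eRk_insert_eq_four hP Finset.inter_subset_right hr (hK he) heP]
    rfl
  · -- the closure of a rank-`3` flat of `M|K` is a plane with rank-`3` trace
    intro F hF
    rw [mem_flatsRestr] at hF
    obtain ⟨hFK, hFr, hflat⟩ := hF
    have hFg : F ⊆ gr M := hFK.trans hK
    obtain ⟨hcl, hsub⟩ := clF_mem_planes hFg hFr
    have htrace : K ∩ clF M F = F := by
      ext e
      simp only [Finset.mem_inter]
      constructor
      · rintro ⟨heK, hecl⟩
        by_contra heF
        have h1 := hflat e heK heF
        have h2 : M.eRk ((insert e F : Finset α) : Set α) = M.eRk (F : Set α) := by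
          apply eRk_insert_eq_of_mem_closure hFg
          rw [← coe_clF]
          exact Finset.mem_coe.2 hecl
        rw [h2, hFr] at h1
        norm_num at h1
      · intro heF
        exact ⟨hFK heF, hsub heF⟩
    rw [Finset.mem_filter]
    refine ⟨hcl, ?_⟩
    rw [htrace, hFr]
    rfl
  · -- left inverse: `cl(K ∩ P) = P`
    intro P hP
    rw [Finset.mem_filter] at hP
    obtain ⟨hP, hr⟩ := hP
    apply Finset.coe_injective
    rw [coe_clF]
    exact closure_eq_of_subset_plane hP Finset.inter_subset_right hr
  · -- right inverse: `K ∩ cl(F) = F`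
    intro F hF
    rw [mem_flatsRestr] at hF
    obtain ⟨hFK, hFr, hflat⟩ := hF
    have hFg : F ⊆ gr M := hFK.trans hK
    obtain ⟨_, hsub⟩ := clF_mem_planes hFg hFr
    ext e
    simp only [Finset.mem_inter]
    constructor
    · rintro ⟨heK, hecl⟩
      by_contra heF
      have h1 := hflat e heK heF
      have h2 : M.eRk ((insert e F : Finset α) : Set α) = M.eRk (F : Set α) := by
        apply eRk_insert_eq_of_mem_closure hFg
        rw [← coe_clF]
        exact Finset.mem_coe.2 hecl
      rw [h2, hFr] at h1
      norm_num at h1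
    · intro heF
      exact ⟨hFK heF, hsub heF⟩
  · intro P _
    rfl

/-- **The flats of `M|(insert y K)` for `y ∉ cl(K)`**: at rank `r ≥ 1` they are the rank-`r` flats of `M|K` together with
`insert y F'` for the rank-`(r − 1)` flats `F'` of `M|K`. -/
theorem flatsRestr_insert_of_notMem_closure {K : Finset α} (hK : K ⊆ gr M) {y : α} (hy : y ∈ gr M)
    (hycl : y ∉ M.closure (K : Set α)) {r : ℕ} (hr : 1 ≤ r) :
    flatsRestr M (insert y K) r = flatsRestr M K r ∪ (flatsRestr M K (r - 1)).image (insert y) := by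
  classical
  have hKE : (K : Set α) ⊆ M.E := by rw [← coe_gr M]; exact_mod_cast hK
  have hyK : y ∉ K := fun h => hycl (M.mem_closure_of_mem (Finset.mem_coe.2 h) hKE)
  have hycl' : ∀ F ⊆ K, y ∉ M.closure (F : Set α) := fun F hF h =>
    hycl (M.closure_subset_closure (Finset.coe_subset.2 hF) h)
  ext F
  simp only [Finset.mem_union, Finset.mem_image, mem_flatsRestr]
  constructor
  · rintro ⟨hFK, hFr, hflat⟩
    by_cases hyF : y ∈ F
    · right
      refine ⟨F.erase y, ⟨?_, ?_, ?_⟩, Finset.insert_erase hyF⟩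
      · intro e he
        have he' := Finset.mem_of_mem_erase he
        rcases Finset.mem_insert.1 (hFK he') with rfl | heK
        · exact absurd rfl (Finset.ne_of_mem_erase he)
        · exact heK
      · -- the rank of `F ∖ y` is `r − 1`
        have hsub : F.erase y ⊆ K := by
          intro e he
          have he' := Finset.mem_of_mem_erase he
          rcases Finset.mem_insert.1 (hFK he') with rfl | heK
          · exact absurd rfl (Finset.ne_of_mem_erase he)
          · exact heK
        have h1 : M.eRk ((insert y (F.erase y) : Finset α) : Set α) = M.eRk ((F.erase y : Finset α) : Set α) + 1 :=
          eRk_insert_eq_succ_of_notMem_closure hy (hycl' _ hsub)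
        rw [Finset.insert_erase hyF, hFr] at h1
        obtain ⟨k, hk, -⟩ := ThmH.eRk_eq_nat M (F.erase y)
        rw [hk] at h1 ⊢
        have h2 : ((k + 1 : ℕ) : ℕ∞) = (r : ℕ∞) := by rw [Nat.cast_succ]; exact h1.symm
        have h3 : k + 1 = r := by exact_mod_cast h2
        congr 1
        omega
      · -- the flat condition of `F ∖ y` inside `K`
        intro e heK heF'
        have hsub : F.erase y ⊆ K := by
          intro e' he'
          have he'' := Finset.mem_of_mem_erase he'
          rcases Finset.mem_insert.1 (hFK he'') with rfl | heK'
          · exact absurd rfl (Finset.ne_of_mem_erase he')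
          · exact heK'
        have hey : e ≠ y := fun h => hyK (h ▸ heK)
        have heF : e ∉ F := fun h => heF' (Finset.mem_erase.2 ⟨hey, h⟩)
        have h1 := hflat e (Finset.mem_insert_of_mem heK) heF
        have hcomm : (insert e F : Finset α) = insert y (insert e (F.erase y)) := by
          rw [Finset.insert_comm, Finset.insert_erase hyF]
        have hsub' : insert e (F.erase y) ⊆ K := Finset.insert_subset heK hsub
        have h2 : M.eRk ((insert y (insert e (F.erase y)) : Finset α) : Set α) =
            M.eRk ((insert e (F.erase y) : Finset α) : Set α) + 1 :=
          eRk_insert_eq_succ_of_notMem_closure hy (hycl' _ hsub')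
        rw [hcomm, h2] at h1
        obtain ⟨k, hk, -⟩ := ThmH.eRk_eq_nat M (insert e (F.erase y))
        rw [hk] at h1 ⊢
        have h3 : ((k + 1 : ℕ) : ℕ∞) = ((r + 1 : ℕ) : ℕ∞) := by rw [Nat.cast_succ]; exact h1
        have h4 : k + 1 = r + 1 := by exact_mod_cast h3
        congr 1
        omega
    · left
      refine ⟨?_, hFr, ?_⟩
      · intro e he
        rcases Finset.mem_insert.1 (hFK he) with rfl | heK
        · exact absurd he hyF
        · exact heK
      · intro e he heF
        exact hflat e (Finset.mem_insert_of_mem he) heF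
  · rintro (⟨hFK, hFr, hflat⟩ | ⟨F', ⟨hF'K, hF'r, hflat'⟩, rfl⟩)
    · refine ⟨hFK.trans (Finset.subset_insert _ _), hFr, ?_⟩
      intro e he heF
      rcases Finset.mem_insert.1 he with rfl | heK
      · rw [eRk_insert_eq_succ_of_notMem_closure hy (hycl' _ hFK), hFr]
        rfl
      · exact hflat e heK heF
    · refine ⟨Finset.insert_subset_insert _ hF'K, ?_, ?_⟩
      · rw [eRk_insert_eq_succ_of_notMem_closure hy (hycl' _ hF'K), hF'r]
        obtain ⟨r', rfl⟩ : ∃ r', r = r' + 1 := ⟨r - 1, by omega⟩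
        simp only [Nat.add_sub_cancel]
        push_cast
        ring
      · intro e he heF
        have hey : e ≠ y := fun h => heF (h ▸ Finset.mem_insert_self _ _)
        have heK : e ∈ K := by
          rcases Finset.mem_insert.1 he with rfl | heK
          · exact absurd rfl hey
          · exact heK
        have heF' : e ∉ F' := fun h => heF (Finset.mem_insert_of_mem h)
        have hcomm : (insert e (insert y F') : Finset α) = insert y (insert e F') := Finset.insert_comm _ _ _
        have hsub' : insert e F' ⊆ K := Finset.insert_subset heK hF'K
        rw [hcomm, eRk_insert_eq_succ_of_notMem_closure hy (hycl' _ hsub'), hflat' e heK heF']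
        obtain ⟨r', rfl⟩ : ∃ r', r = r' + 1 := ⟨r - 1, by omega⟩
        simp only [Nat.add_sub_cancel]
        push_cast
        ring

/-- The rank-`0` flats of `M|(insert y K)` for `y ∉ cl(K)` are those of `M|K` (`y` is not a loop). -/
theorem flatsRestr_insert_zero_of_notMem_closure {K : Finset α} (hK : K ⊆ gr M) {y : α} (hy : y ∈ gr M)
    (hycl : y ∉ M.closure (K : Set α)) :
    flatsRestr M (insert y K) 0 = flatsRestr M K 0 := by
  classical
  have hKE : (K : Set α) ⊆ M.E := by rw [← coe_gr M]; exact_mod_cast hK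
  have hyK : y ∉ K := fun h => hycl (M.mem_closure_of_mem (Finset.mem_coe.2 h) hKE)
  have hycl' : ∀ F ⊆ K, y ∉ M.closure (F : Set α) := fun F hF h =>
    hycl (M.closure_subset_closure (Finset.coe_subset.2 hF) h)
  ext F
  simp only [mem_flatsRestr]
  constructor
  · rintro ⟨hFK, hFr, hflat⟩
    have hyF : y ∉ F := by
      intro hyF
      -- a rank-`0` set containing `y` would put `y` in `cl(∅) ⊆ cl(K)`
      have h1 : M.eRk ((insert y (∅ : Finset α) : Finset α) : Set α) ≤ M.eRk (F : Set α) := by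
        apply M.eRk_mono
        rw [Finset.coe_insert, Finset.coe_empty, insert_empty_eq]
        exact Set.singleton_subset_iff.2 (Finset.mem_coe.2 hyF)
      have h2 : M.eRk ((insert y (∅ : Finset α) : Finset α) : Set α) = M.eRk ((∅ : Finset α) : Set α) + 1 :=
        eRk_insert_eq_succ_of_notMem_closure hy (hycl' ∅ (Finset.empty_subset _))
      rw [h2, hFr, Finset.coe_empty, Matroid.eRk_empty] at h1
      norm_num at h1
    refine ⟨?_, hFr, ?_⟩
    · intro e he
      rcases Finset.mem_insert.1 (hFK he) with rfl | heK
      · exact absurd he hyF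
      · exact heK
    · intro e he heF
      exact hflat e (Finset.mem_insert_of_mem he) heF
  · rintro ⟨hFK, hFr, hflat⟩
    refine ⟨hFK.trans (Finset.subset_insert _ _), hFr, ?_⟩
    intro e he heF
    rcases Finset.mem_insert.1 he with rfl | heK
    · rw [eRk_insert_eq_succ_of_notMem_closure hy (hycl' _ hFK), hFr]
      rfl
    · exact hflat e heK heF

/-- **The coloop step**: for `y ∉ cl(K)` and `r ≥ 1`, `Φ_r(insert y K) = Φ_r(K) + Φ_{r−1}(K)`. -/
theorem Phi_insert_of_notMem_closure {K : Finset α} (hK : K ⊆ gr M) {y : α} (hy : y ∈ gr M)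
    (hycl : y ∉ M.closure (K : Set α)) {r : ℕ} (hr : 1 ≤ r) :
    Phi M r (insert y K) = Phi M r K + Phi M (r - 1) K := by
  classical
  have hKE : (K : Set α) ⊆ M.E := by rw [← coe_gr M]; exact_mod_cast hK
  have hyK : y ∉ K := fun h => hycl (M.mem_closure_of_mem (Finset.mem_coe.2 h) hKE)
  unfold Phi
  rw [flatsRestr_insert_of_notMem_closure hK hy hycl hr, Finset.sum_union, Finset.sum_image]
  · congr 1
    apply Finset.sum_congr rfl
    intro F' hF'
    rw [mem_flatsRestr] at hF'
    have hyF' : y ∉ F' := fun h => hyK (hF'.1 h)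
    rw [Finset.card_insert_of_notMem hyF']
    obtain ⟨r', rfl⟩ : ∃ r', r = r' + 1 := ⟨r - 1, by omega⟩
    have hcard : r' ≤ F'.card := by
      have h := M.eRk_le_encard (F' : Set α)
      rw [hF'.2.1, Set.encard_coe_eq_coe_finsetCard] at h
      have h' : r' + 1 - 1 ≤ F'.card := by exact_mod_cast h
      omega
    congr 1
    omega
  · intro F₁ hF₁ F₂ hF₂ h
    have hyF₁ : y ∉ F₁ := fun hh => hyK ((mem_flatsRestr.1 (Finset.mem_coe.1 hF₁)).1 hh)
    have hyF₂ : y ∉ F₂ := fun hh => hyK ((mem_flatsRestr.1 (Finset.mem_coe.1 hF₂)).1 hh)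
    have := congrArg (fun S : Finset α => S.erase y) h
    simp only [Finset.erase_insert hyF₁, Finset.erase_insert hyF₂] at this
    exact this
  · rw [Finset.disjoint_left]
    intro F hF hF'
    rw [Finset.mem_image] at hF'
    obtain ⟨F', _, rfl⟩ := hF'
    exact hyK ((mem_flatsRestr.1 hF).1 (Finset.mem_insert_self _ _))

/-- The rank-`0` count is unchanged by a point outside `cl(K)`. -/
theorem Phi_zero_insert_of_notMem_closure {K : Finset α} (hK : K ⊆ gr M) {y : α} (hy : y ∈ gr M)
    (hycl : y ∉ M.closure (K : Set α)) :
    Phi M 0 (insert y K) = Phi M 0 K := by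
  unfold Phi
  rw [flatsRestr_insert_zero_of_notMem_closure hK hy hycl]

/-- **The coloop direct sum**: if every `y ∈ Y ⊆ E` lies outside `cl(K ∪ (Y ∖ y))` (the points of `Y` are coloops of
`M|(K ∪ Y)`), then `Φ_r(K ∪ Y) = Σ_{j ≤ r} C(|Y|, j) · Φ_{r−j}(K)` for every `r`. -/
theorem Phi_union_of_coloops {K : Finset α} (hK : K ⊆ gr M) (Y : Finset α) (hY : Y ⊆ gr M)
    (hcol : ∀ y ∈ Y, y ∉ M.closure ((K ∪ Y.erase y : Finset α) : Set α)) (r : ℕ) :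
    Phi M r (K ∪ Y) = ∑ j ∈ Finset.range (r + 1), ((Y.card.choose j : ℕ) : ℚ) * Phi M (r - j) K := by
  classical
  induction Y using Finset.induction_on generalizing r with
  | empty =>
    simp only [Finset.union_empty, Finset.card_empty]
    rw [Finset.sum_range_succ']
    simp only [Nat.choose_zero_right, Nat.cast_one, one_mul, Nat.sub_zero]
    have : ∀ j ∈ Finset.range r, ((Nat.choose 0 (j + 1) : ℕ) : ℚ) * Phi M (r - (j + 1)) K = 0 := by
      intro j _
      rw [Nat.choose_eq_zero_of_lt (by omega)]
      simp
    rw [Finset.sum_eq_zero this]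
    ring
  | insert y Y' hyY' ih =>
    have hY' : Y' ⊆ gr M := (Finset.subset_insert _ _).trans hY
    have hy : y ∈ gr M := hY (Finset.mem_insert_self _ _)
    have hcol' : ∀ y' ∈ Y', y' ∉ M.closure ((K ∪ Y'.erase y' : Finset α) : Set α) := by
      intro y' hy' h
      apply hcol y' (Finset.mem_insert_of_mem hy')
      apply M.closure_subset_closure _ h
      rw [Finset.coe_subset]
      apply Finset.union_subset_union (subset_refl _)
      intro z hz
      rw [Finset.mem_erase] at hz ⊢
      exact ⟨hz.1, Finset.mem_insert_of_mem hz.2⟩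
    have hycl : y ∉ M.closure ((K ∪ Y' : Finset α) : Set α) := by
      have h := hcol y (Finset.mem_insert_self _ _)
      rwa [Finset.erase_insert hyY'] at h
    have hKY' : K ∪ Y' ⊆ gr M := Finset.union_subset hK hY'
    rw [Finset.union_insert, Finset.card_insert_of_notMem hyY']
    rcases Nat.eq_zero_or_pos r with rfl | hr
    · rw [Phi_zero_insert_of_notMem_closure hKY' hy hycl, ih hY' hcol' 0]
      simp
    · rw [Phi_insert_of_notMem_closure hKY' hy hycl hr, ih hY' hcol' r, ih hY' hcol' (r - 1)]
      obtain ⟨r', rfl⟩ : ∃ r', r = r' + 1 := ⟨r - 1, by omega⟩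
      simp only [Nat.add_sub_cancel]
      set n := Y'.card with hn
      have e1 : ∑ j ∈ Finset.range (r' + 1 + 1), ((Nat.choose (n + 1) j : ℕ) : ℚ) * Phi M (r' + 1 - j) K =
          ∑ j ∈ Finset.range (r' + 1), ((Nat.choose (n + 1) (j + 1) : ℕ) : ℚ) * Phi M (r' + 1 - (j + 1)) K +
            ((Nat.choose (n + 1) 0 : ℕ) : ℚ) * Phi M (r' + 1 - 0) K :=
        Finset.sum_range_succ' _ _
      have e2 : ∑ j ∈ Finset.range (r' + 1 + 1), ((Nat.choose n j : ℕ) : ℚ) * Phi M (r' + 1 - j) K =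
          ∑ j ∈ Finset.range (r' + 1), ((Nat.choose n (j + 1) : ℕ) : ℚ) * Phi M (r' + 1 - (j + 1)) K +
            ((Nat.choose n 0 : ℕ) : ℚ) * Phi M (r' + 1 - 0) K :=
        Finset.sum_range_succ' _ _
      have hrw : ∀ j ∈ Finset.range (r' + 1),
          ((Nat.choose (n + 1) (j + 1) : ℕ) : ℚ) * Phi M (r' + 1 - (j + 1)) K =
            ((Nat.choose n j : ℕ) : ℚ) * Phi M (r' - j) K +
              ((Nat.choose n (j + 1) : ℕ) : ℚ) * Phi M (r' + 1 - (j + 1)) K := by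
        intro j _
        have hidx : r' + 1 - (j + 1) = r' - j := by omega
        rw [hidx, Nat.choose_succ_succ, Nat.cast_add, add_mul]
      rw [e1, e2, Finset.sum_congr rfl hrw, Finset.sum_add_distrib]
      simp only [Nat.choose_zero_right, Nat.cast_one, one_mul, Nat.sub_zero]
      ring

end SevenThree

end PercRepro
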